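import Literature.NumberTheory.LFunctions.WeilTwoPrimeCells
import Literature.NumberTheory.LFunctions.WeilFirstPrimeMinorant
import HarnessLib

/-!
# The certified piecewise-polynomial minorant of the two-prime Weil weight

Topic: `Literature/NumberTheory/LFunctions`. Chain assembly for the two-prime cells `TPDCell` of
`WeilTwoPrimeCells.lean` (weight
`w₂₃(t) = Re ψ(1/4 + it/2) − √2 log 2 cos(t log 2) − (2 log 3/√3) cos(t log 3)`,
`Literature.NumberTheory.LFunctions.weilTwoPrimeWeight`), by verbatim adaptation of the first-prime
chain layer (`WeilFirstPrimeMinorant.lean`, `WeilFirstPrimeMinorantV.lean`):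

* `cellsGamma₂₃ wL cells` — the even function `γ` built from a chain of two-prime cells on `[0, T)`
  (`gammaAux₂₃`), `checkChain₂₃`, the check-free validity predicate `CellsOK₂₃` (chain from `0` to
  `T`, every cell valid, and the level `wL ≤ w₂₃(t)` for `|t| ≥ T`), and the integer checker
  `checkCells₂₃` (every cell `TPDCell.checkZ`, `T` dyadic, level test
  `wL + c₀⁺ + c₃⁺ ≤ wLoZ` at `T`: beyond `T` the digamma part is monotone and each ripple is at most
  its amplitude), `cellsOK_of_checkCells₂₃`;
* soundness `level_sub_cellsGamma₂₃_le` (`wL − γ(t) ≤ w₂₃(t)` for all real `t`),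
  `cellsGamma₂₃_eq_zero`, the sup bounds `abs_cellsGamma₂₃_le_bndSum`, `abs_cellsGamma₂₃_le_bndMax`,
  the `|γ|`-moment bound `integral_abs_cellsGamma₂₃_mul_pow_le`, boundedness, measurability;
* exact rational moments `cellsMomentQ₂₃` and `integral_cellsGamma₂₃_mul_pow`
  (`∫ γ(t) t^q dt = 2 Σ_j momentQ_j(q)` for even `q`).

Everything here is proved; there are no named facts.

## References

* H. Yoshida, *On Hermitian forms attached to zeta functions*, Adv. Stud. Pure Math. 21 (1992), §6.
  [Yoshida1992]
-/

noncomputable section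

open Complex Filter Set MeasureTheory
open scoped Real Topology

namespace Literature.NumberTheory.LFunctions

open Literature.Analysis.ValidatedNumerics.Numerics
open Literature.Analysis.SpecialFunctions

/-! ## The piecewise minorant built from a chain of two-prime cells -/

/-- `γ` on `[0, ∞)`: `Σ_j 1_{[u_j, v_j)}(s) (wL − σ_j(s))` (two-prime cells). [folklore] -/
def gammaAux₂₃ (wL : ℚ) : List TPDCell → ℝ → ℝ
  | [], _ => 0
  | c :: cs, s =>
    Set.indicator (Ico (c.fp.psi.u : ℝ) c.fp.psi.v) (fun s ↦ (wL : ℝ) - c.sigma s) s + gammaAux₂₃ wL cs s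

/-- The even function `γ(t) = γ_{≥0}(|t|)`; the minorant of `w₂₃` is `σ = wL − γ`. [folklore] -/
def cellsGamma₂₃ (wL : ℚ) (cells : List TPDCell) (t : ℝ) : ℝ :=
  gammaAux₂₃ wL cells |t|

/-- The cells are consecutive: `u_0 = s`, `u_{j+1} = v_j`, last `v = T`. [folklore] -/
def checkChain₂₃ : List TPDCell → ℚ → ℚ → Bool
  | [], s, T => decide (s = T)
  | c :: cs, s, T => decide (c.fp.psi.u = s) && checkChain₂₃ cs c.fp.psi.v T

/-! ## Valid chains and the integer checker -/

/-- A valid chain at level `wL` on `[0, T]` for the two-prime weight: consecutive valid cells from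
`0` to `T`, and the level `wL ≤ w₂₃(t)` for `|t| ≥ T`. [folklore] -/
structure CellsOK₂₃ (wL T : ℚ) (cells : List TPDCell) : Prop where
  /-- the cells form a chain from `0` to `T` -/
  chain : checkChain₂₃ cells 0 T = true
  /-- every cell is valid -/
  valid : ∀ c ∈ cells, c.Valid
  /-- the level beyond `T`: `wL ≤ w₂₃(t)` for `|t| ≥ T` -/
  level : ∀ t : ℝ, (T : ℝ) ≤ |t| → (wL : ℝ) ≤ weilTwoPrimeWeight t

/-- **The integer checker of a two-prime chain**: chain from `0` to `T`, every cell `checkZ`,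
`j ≥ 1`, `T` dyadic, and the level test `wL + c₀⁺ + c₃⁺ ≤ wLoZ` at `T` (one amplitude per ripple).
[folklore] -/
def checkCells₂₃ (p j : ℕ) (wL T : ℚ) (mwT : ℕ) (cells : List TPDCell) : Bool :=
  checkChain₂₃ cells 0 T && cells.all (fun c ↦ c.checkZ p j) && decide (1 ≤ j) &&
    decide (T * 2 ^ j = ((dyNum T j : ℕ) : ℚ)) &&
    decide (wL + cZeroFI.hiQ + cThreeFI.hiQ ≤ wLoZ p (dyNum T j) j mwT)

/-- **The level beyond `T`.** If `0 ≤ T` and `wL + √2 log 2 + 2 log 3/√3 ≤ Re ψ(1/4 + iT/2)` then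
`wL ≤ w₂₃(t)` for `|t| ≥ T`: `Re ψ(1/4 + it/2)` is even and monotone in `|t|`, and each ripple is at
most its amplitude. [folklore] -/
theorem level_of_le₂₃ {wL T : ℚ} (hT : 0 ≤ T)
    (hwL : (wL : ℝ) + Real.sqrt 2 * Real.log 2 + 2 * Real.log 3 / Real.sqrt 3 ≤ reDigammaQuarter T)
    {t : ℝ} (ht : (T : ℝ) ≤ |t|) : (wL : ℝ) ≤ weilTwoPrimeWeight t := by
  have hT' : (0 : ℝ) ≤ T := by exact_mod_cast hT
  rw [weilTwoPrimeWeight, ← reDigammaQuarter_abs t, ← cos_abs_mul t (Real.log 2),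
    ← cos_abs_mul t (Real.log 3)]
  have hc0nn : 0 ≤ Real.sqrt 2 * Real.log 2 := by positivity
  have hc3nn : 0 ≤ 2 * Real.log 3 / Real.sqrt 3 := by positivity
  have hcos2 : Real.sqrt 2 * Real.log 2 * Real.cos (|t| * Real.log 2) ≤ Real.sqrt 2 * Real.log 2 :=
    mul_le_of_le_one_right hc0nn (Real.cos_le_one _)
  have hcos3 : 2 * Real.log 3 / Real.sqrt 3 * Real.cos (|t| * Real.log 3) ≤
      2 * Real.log 3 / Real.sqrt 3 :=
    mul_le_of_le_one_right hc3nn (Real.cos_le_one _)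
  have hmono := reDigammaQuarter_mono (t := |t|) (u := (T : ℝ)) (by rwa [abs_abs, abs_of_nonneg hT'])
  linarith

section Chain

variable {wL : ℚ}

/-- A chain of valid cells from `s` to `T` has `s ≤ T` and all cells inside `[s, T]`. [folklore] -/
theorem chain_bounds₂₃ {cells : List TPDCell} {s T : ℚ} (hchain : checkChain₂₃ cells s T = true)
    (hall : ∀ c ∈ cells, c.Valid) :
    s ≤ T ∧ ∀ c ∈ cells, s ≤ c.fp.psi.u ∧ c.fp.psi.v ≤ T := by
  induction cells generalizing s with
  | nil =>
    simp only [checkChain₂₃, decide_eq_true_eq] at hchain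
    exact ⟨hchain.le, fun c hc ↦ by simp at hc⟩
  | cons c cs ih =>
    simp only [checkChain₂₃, Bool.and_eq_true, decide_eq_true_eq] at hchain
    have hc := hall c (by simp)
    have huv := hc.u_lt_v
    have ih' := ih hchain.2 fun c' hc' ↦ hall c' (by simp [hc'])
    refine ⟨by rw [← hchain.1]; exact huv.le.trans ih'.1, fun c' hc' ↦ ?_⟩
    simp only [List.mem_cons] at hc'
    rcases hc' with rfl | hc'
    · exact ⟨hchain.1.ge, ih'.1⟩
    · have := ih'.2 c' hc'
      exact ⟨hchain.1 ▸ huv.le.trans this.1, this.2⟩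

/-- `γ_{≥0}` vanishes off `[s, T)`. [folklore] -/
theorem gammaAux₂₃_eq_zero {cells : List TPDCell} {s T : ℚ} (hchain : checkChain₂₃ cells s T = true)
    (hall : ∀ c ∈ cells, c.Valid) {x : ℝ} (hx : x < s ∨ (T : ℝ) ≤ x) :
    gammaAux₂₃ wL cells x = 0 := by
  induction cells generalizing s with
  | nil => rfl
  | cons c cs ih =>
    have hb := chain_bounds₂₃ hchain hall
    simp only [checkChain₂₃, Bool.and_eq_true, decide_eq_true_eq] at hchain
    have hcv : (c.fp.psi.v : ℝ) ≤ T := by exact_mod_cast (hb.2 c (by simp)).2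
    have huv : (c.fp.psi.u : ℝ) < c.fp.psi.v := by exact_mod_cast (hall c (by simp)).u_lt_v
    have hus : (c.fp.psi.u : ℝ) = s := by exact_mod_cast hchain.1
    simp only [gammaAux₂₃]
    rw [ih hchain.2 (fun c' hc' ↦ hall c' (by simp [hc'])) ?_, add_zero, Set.indicator_of_notMem]
    · rintro ⟨h1, h2⟩
      rcases hx with hx | hx <;> linarith
    · rcases hx with hx | hx
      · left; linarith
      · right; exact hx

/-- On `[s, T)`, `γ_{≥0}(x) = wL − σ_j(x)` for the cell containing `x`. [folklore] -/
theorem gammaAux₂₃_spec {cells : List TPDCell} {s T : ℚ} (hchain : checkChain₂₃ cells s T = true)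
    (hall : ∀ c ∈ cells, c.Valid) {x : ℝ} (h1 : (s : ℝ) ≤ x) (h2 : x < T) :
    ∃ c ∈ cells, (c.fp.psi.u : ℝ) ≤ x ∧ x < c.fp.psi.v ∧
      gammaAux₂₃ wL cells x = wL - c.sigma x := by
  induction cells generalizing s with
  | nil =>
    simp only [checkChain₂₃, decide_eq_true_eq] at hchain
    rw [hchain] at h1
    linarith
  | cons c cs ih =>
    simp only [checkChain₂₃, Bool.and_eq_true, decide_eq_true_eq] at hchain
    have hus : (c.fp.psi.u : ℝ) = s := by exact_mod_cast hchain.1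
    have hall' : ∀ c' ∈ cs, c'.Valid := fun c' hc' ↦ hall c' (by simp [hc'])
    by_cases hxv : x < c.fp.psi.v
    · refine ⟨c, by simp, by linarith, hxv, ?_⟩
      simp only [gammaAux₂₃]
      have hmem : x ∈ Ico (c.fp.psi.u : ℝ) c.fp.psi.v := ⟨by linarith, hxv⟩
      rw [gammaAux₂₃_eq_zero hchain.2 hall' (Or.inl hxv), add_zero, Set.indicator_of_mem hmem]
    · push Not at hxv
      obtain ⟨c', hc', hr⟩ := ih hchain.2 hall' hxv
      refine ⟨c', by simp [hc'], hr.1, hr.2.1, ?_⟩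
      simp only [gammaAux₂₃]
      rw [Set.indicator_of_notMem (fun h ↦ not_lt.2 hxv h.2), zero_add, hr.2.2]

end Chain

/-- The integer checker yields a valid chain. [folklore] -/
theorem cellsOK_of_checkCells₂₃ {p j : ℕ} {wL T : ℚ} {mwT : ℕ} {cells : List TPDCell}
    (h : checkCells₂₃ p j wL T mwT cells = true) : CellsOK₂₃ wL T cells := by
  simp only [checkCells₂₃, Bool.and_eq_true, List.all_eq_true, decide_eq_true_eq] at h
  obtain ⟨⟨⟨⟨hchain, hall⟩, hj⟩, hT⟩, hwL⟩ := h
  have hvalid : ∀ c ∈ cells, c.Valid := fun c hc ↦ TPDCell.valid_of_checkZ (hall c hc)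
  have hT0 : 0 ≤ T := (chain_bounds₂₃ hchain hvalid).1
  refine ⟨hchain, hvalid, fun t ht ↦ level_of_le₂₃ hT0 ?_ ht⟩
  have hc0 : Real.sqrt 2 * Real.log 2 ≤ (cZeroFI.hiQ : ℝ) := FI.le_hiQ mem_cZeroFI
  have hc3 : 2 * Real.log 3 / Real.sqrt 3 ≤ (cThreeFI.hiQ : ℝ) := FI.le_hiQ mem_cThreeFI
  have hwL' : ((wL : ℚ) : ℝ) + cZeroFI.hiQ + cThreeFI.hiQ ≤ wLoZ p (dyNum T j) j mwT := by
    exact_mod_cast hwL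
  have hTe : ((dyNum T j : ℕ) : ℝ) / 2 ^ j = (T : ℝ) := by
    have : (T : ℝ) * 2 ^ j = ((dyNum T j : ℕ) : ℝ) := by exact_mod_cast hT
    rw [← this, mul_div_assoc, div_self (by positivity), mul_one]
  have hlev := wLoZ_le p (dyNum T j) hj mwT
  rw [hTe] at hlev
  linarith

/-! ## Boundedness and measurability -/

/-- `γ_{≥0}` is bounded. [folklore] -/
theorem exists_abs_gammaAux₂₃_le (wL : ℚ) (cells : List TPDCell) :
    ∃ B, ∀ x, |gammaAux₂₃ wL cells x| ≤ B := by
  induction cells with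
  | nil => exact ⟨0, fun x ↦ by simp [gammaAux₂₃]⟩
  | cons c cs ih =>
    obtain ⟨B, hB⟩ := ih
    obtain ⟨C, hC⟩ := (isCompact_Icc (a := (c.fp.psi.u : ℝ)) (b := c.fp.psi.v)).exists_bound_of_continuousOn
      ((continuous_const.sub c.continuous_sigma).continuousOn
        (s := Icc (c.fp.psi.u : ℝ) c.fp.psi.v) (f := fun s ↦ (wL : ℝ) - c.sigma s))
    refine ⟨max C 0 + B, fun x ↦ ?_⟩
    simp only [gammaAux₂₃]
    refine (abs_add_le _ _).trans (add_le_add ?_ (hB x))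
    by_cases hx : x ∈ Ico (c.fp.psi.u : ℝ) c.fp.psi.v
    · rw [Set.indicator_of_mem hx]
      have := hC x (Ico_subset_Icc_self hx)
      rw [Real.norm_eq_abs] at this
      exact this.trans (le_max_left _ _)
    · rw [Set.indicator_of_notMem hx, abs_zero]
      exact le_max_right _ _

/-- `γ` is bounded. [folklore] -/
theorem exists_abs_cellsGamma₂₃_le (wL : ℚ) (cells : List TPDCell) :
    ∃ B, 0 ≤ B ∧ ∀ t, |cellsGamma₂₃ wL cells t| ≤ B := by
  obtain ⟨B, hB⟩ := exists_abs_gammaAux₂₃_le wL cells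
  exact ⟨B, (abs_nonneg _).trans (hB 0), fun t ↦ hB |t|⟩

/-- `γ_{≥0}` is measurable. [folklore] -/
theorem measurable_gammaAux₂₃ (wL : ℚ) (cells : List TPDCell) :
    Measurable (gammaAux₂₃ wL cells) := by
  induction cells with
  | nil => exact measurable_const
  | cons c cs ih =>
    change Measurable fun s ↦
      Set.indicator (Ico (c.fp.psi.u : ℝ) c.fp.psi.v) (fun s ↦ (wL : ℝ) - c.sigma s) s +
        gammaAux₂₃ wL cs s
    exact ((measurable_const.sub c.continuous_sigma.measurable).indicator measurableSet_Ico).add ih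

/-- `γ` is measurable. [folklore] -/
theorem measurable_cellsGamma₂₃ (wL : ℚ) (cells : List TPDCell) :
    Measurable (cellsGamma₂₃ wL cells) :=
  (measurable_gammaAux₂₃ wL cells).comp continuous_abs.measurable

/-- `γ` is even. [folklore] -/
theorem cellsGamma₂₃_neg (wL : ℚ) (cells : List TPDCell) (t : ℝ) :
    cellsGamma₂₃ wL cells (-t) = cellsGamma₂₃ wL cells t := by
  unfold cellsGamma₂₃; rw [abs_neg]

section Sound

variable {wL T : ℚ} {cells : List TPDCell}

/-- **Soundness of a certified two-prime minorant.**
`wL − γ(t) ≤ w₂₃(t) = Re ψ(1/4 + it/2) − √2 log 2 cos(t log 2) − (2 log 3/√3) cos(t log 3)` for all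
real `t`. [folklore] -/
theorem level_sub_cellsGamma₂₃_le (h : CellsOK₂₃ wL T cells) (t : ℝ) :
    (wL : ℝ) - cellsGamma₂₃ wL cells t ≤ weilTwoPrimeWeight t := by
  have hchain := h.chain
  have hall := h.valid
  unfold cellsGamma₂₃
  have hx0 : (0 : ℝ) ≤ |t| := abs_nonneg t
  rcases lt_or_ge |t| (T : ℝ) with hxT | hxT
  · obtain ⟨c, hc, hux, hxv, hval⟩ := gammaAux₂₃_spec hchain hall (by exact_mod_cast hx0) hxT
    rw [hval, sub_sub_cancel]
    have h1 := (hall c hc).sigma_le |t| hux hxv.le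
    have e : weilTwoPrimeWeight |t| = weilTwoPrimeWeight t := by
      unfold weilTwoPrimeWeight
      rw [reDigammaQuarter_abs t, cos_abs_mul t, cos_abs_mul t]
    rwa [e] at h1
  · rw [gammaAux₂₃_eq_zero hchain hall (Or.inr hxT), sub_zero]
    exact h.level t hxT

/-- `γ(t) = 0` for `|t| ≥ T`. [folklore] -/
theorem cellsGamma₂₃_eq_zero (h : CellsOK₂₃ wL T cells) {t : ℝ} (ht : (T : ℝ) ≤ |t|) :
    cellsGamma₂₃ wL cells t = 0 :=
  gammaAux₂₃_eq_zero h.chain h.valid (Or.inr ht)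

end Sound

/-! ## Signed `γ`: a step-function bound and its moments -/

/-- The step function `Σ_j bnd_j 1_{[u_j, v_j)}` dominating `|γ_{≥0}|`. [folklore] -/
def stepAux₂₃ (wL : ℚ) : List TPDCell → ℝ → ℝ
  | [], _ => 0
  | c :: cs, s =>
    Set.indicator (Ico (c.fp.psi.u : ℝ) c.fp.psi.v) (fun _ ↦ ((c.bndQ wL : ℚ) : ℝ)) s + stepAux₂₃ wL cs s

/-- `|γ_{≥0}(s)| ≤ step(s)` when all cells are valid. [folklore] -/
theorem abs_gammaAux₂₃_le_step {wL : ℚ} {cells : List TPDCell}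
    (hall : ∀ c ∈ cells, c.Valid) (s : ℝ) :
    |gammaAux₂₃ wL cells s| ≤ stepAux₂₃ wL cells s := by
  induction cells with
  | nil => simp [gammaAux₂₃, stepAux₂₃]
  | cons c cs ih =>
    simp only [gammaAux₂₃, stepAux₂₃]
    refine (abs_add_le _ _).trans (add_le_add ?_ (ih fun c' hc' ↦ hall c' (by simp [hc'])))
    by_cases hs : s ∈ Ico (c.fp.psi.u : ℝ) c.fp.psi.v
    · rw [Set.indicator_of_mem hs, Set.indicator_of_mem hs]
      exact (hall c (by simp)).abs_le wL s hs.1 hs.2.le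
    · rw [Set.indicator_of_notMem hs, Set.indicator_of_notMem hs, abs_zero]

/-- `step` is bounded, nonnegative and measurable. [folklore] -/
theorem stepAux₂₃_props {wL : ℚ} {cells : List TPDCell} (hall : ∀ c ∈ cells, c.Valid) :
    (∃ B, ∀ s, 0 ≤ stepAux₂₃ wL cells s ∧ stepAux₂₃ wL cells s ≤ B) ∧
      Measurable (stepAux₂₃ wL cells) := by
  induction cells with
  | nil => exact ⟨⟨0, fun s ↦ by simp [stepAux₂₃]⟩, measurable_const⟩
  | cons c cs ih =>
    obtain ⟨⟨B, hB⟩, hm⟩ := ih fun c' hc' ↦ hall c' (by simp [hc'])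
    have hb0 : (0 : ℝ) ≤ ((c.bndQ wL : ℚ) : ℝ) := by
      exact_mod_cast (hall c (by simp)).bndQ_nonneg wL
    refine ⟨⟨((c.bndQ wL : ℚ) : ℝ) + B, fun s ↦ ?_⟩, ?_⟩
    · simp only [stepAux₂₃]
      by_cases hs : s ∈ Ico (c.fp.psi.u : ℝ) c.fp.psi.v
      · rw [Set.indicator_of_mem hs]; exact ⟨add_nonneg hb0 (hB s).1, add_le_add le_rfl (hB s).2⟩
      · rw [Set.indicator_of_notMem hs, zero_add]
        exact ⟨(hB s).1, (hB s).2.trans (by linarith)⟩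
    · change Measurable fun s ↦
        Set.indicator (Ico (c.fp.psi.u : ℝ) c.fp.psi.v) (fun _ ↦ ((c.bndQ wL : ℚ) : ℝ)) s +
          stepAux₂₃ wL cs s
      exact (measurable_const.indicator measurableSet_Ico).add hm

/-- The moments of the step bound: `Σ_j bnd_j (v_j^{q+1} − u_j^{q+1})/(q+1)`. [folklore] -/
def cellsAbsMomentQ₂₃ (wL : ℚ) : List TPDCell → ℕ → ℚ
  | [], _ => 0
  | c :: cs, q => c.bndQ wL * c.fp.psi.powIntQ (q + 1) + cellsAbsMomentQ₂₃ wL cs q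

/-- **Moments of the step bound.** `s ↦ step(s) s^q` is integrable and
`∫ step(s) s^q ds = cellsAbsMomentQ₂₃`. [folklore] -/
theorem integral_stepAux₂₃_mul_pow {wL : ℚ} {cells : List TPDCell}
    (hall : ∀ c ∈ cells, c.Valid) (q : ℕ) :
    Integrable (fun s ↦ stepAux₂₃ wL cells s * s ^ q) ∧
      ∫ s, stepAux₂₃ wL cells s * s ^ q = (cellsAbsMomentQ₂₃ wL cells q : ℝ) := by
  induction cells with
  | nil => simp [stepAux₂₃, cellsAbsMomentQ₂₃]
  | cons c cs ih =>
    obtain ⟨ihi, ihv⟩ := ih fun c' hc' ↦ hall c' (by simp [hc'])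
    have huv : (c.fp.psi.u : ℝ) ≤ c.fp.psi.v := by exact_mod_cast ((hall c (by simp)).u_lt_v).le
    have e : (fun s ↦ stepAux₂₃ wL (c :: cs) s * s ^ q) = fun s ↦
        Set.indicator (Ico (c.fp.psi.u : ℝ) c.fp.psi.v) (fun s ↦ ((c.bndQ wL : ℚ) : ℝ) * s ^ q) s +
          stepAux₂₃ wL cs s * s ^ q := by
      funext s
      simp only [stepAux₂₃, add_mul, Set.indicator_mul_left]
    rw [e]
    have i1 : Integrable fun s : ℝ ↦
        Set.indicator (Ico (c.fp.psi.u : ℝ) c.fp.psi.v) (fun s ↦ ((c.bndQ wL : ℚ) : ℝ) * s ^ q) s := by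
      rw [integrable_indicator_iff measurableSet_Ico]
      exact ((continuous_const.mul (continuous_pow q)).continuousOn.integrableOn_Icc
        (a := (c.fp.psi.u : ℝ)) (b := c.fp.psi.v)).mono_set Ico_subset_Icc_self
    refine ⟨i1.add ihi, ?_⟩
    rw [integral_add i1 ihi, ihv, integral_indicator measurableSet_Ico, integral_Ico_eq_integral_Ioo,
      ← integral_Ioc_eq_integral_Ioo, ← intervalIntegral.integral_of_le huv,
      intervalIntegral.integral_const_mul, WeilCell.integral_pow_eq_powIntQ, cellsAbsMomentQ₂₃]
    push_cast
    ring

/-! ## Exact moments of the minorant -/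

/-- The moments of `γ_{≥0}`: `Σ_j momentQ_j`. [folklore] -/
def cellsMomentQ₂₃ (wL : ℚ) : List TPDCell → ℕ → ℚ
  | [], _ => 0
  | c :: cs, q => c.momentQ wL q + cellsMomentQ₂₃ wL cs q

section Moments

variable {wL : ℚ}

/-- The cell integrands `1_{[u,v)} (wL − σ) s^q` are integrable. [folklore] -/
theorem integrable_indicator_cell₂₃ (wL : ℚ) (c : TPDCell) (q : ℕ) :
    Integrable fun s : ℝ ↦ Set.indicator (Ico (c.fp.psi.u : ℝ) c.fp.psi.v)
      (fun s ↦ ((wL : ℝ) - c.sigma s) * s ^ q) s := by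
  rw [integrable_indicator_iff measurableSet_Ico]
  exact (((continuous_const.sub c.continuous_sigma).mul (continuous_pow q)).continuousOn.integrableOn_Icc
    (a := (c.fp.psi.u : ℝ)) (b := c.fp.psi.v)).mono_set Ico_subset_Icc_self

/-- **Moments of `γ_{≥0}`.** `s ↦ γ_{≥0}(s) s^q` is integrable and
`∫ γ_{≥0}(s) s^q ds = Σ_j momentQ_j`. [folklore] -/
theorem integral_gammaAux₂₃_mul_pow {cells : List TPDCell} (hall : ∀ c ∈ cells, c.Valid)
    (q : ℕ) :
    Integrable (fun s ↦ gammaAux₂₃ wL cells s * s ^ q) ∧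
      ∫ s, gammaAux₂₃ wL cells s * s ^ q = (cellsMomentQ₂₃ wL cells q : ℝ) := by
  induction cells with
  | nil => simp [gammaAux₂₃, cellsMomentQ₂₃]
  | cons c cs ih =>
    obtain ⟨ihi, ihv⟩ := ih fun c' hc' ↦ hall c' (by simp [hc'])
    have huv : (c.fp.psi.u : ℝ) ≤ c.fp.psi.v := by exact_mod_cast ((hall c (by simp)).u_lt_v).le
    have e : (fun s ↦ gammaAux₂₃ wL (c :: cs) s * s ^ q) = fun s ↦
        Set.indicator (Ico (c.fp.psi.u : ℝ) c.fp.psi.v) (fun s ↦ ((wL : ℝ) - c.sigma s) * s ^ q) s +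
          gammaAux₂₃ wL cs s * s ^ q := by
      funext s
      simp only [gammaAux₂₃, add_mul, Set.indicator_mul_left]
    rw [e]
    have i1 := integrable_indicator_cell₂₃ wL c q
    refine ⟨i1.add ihi, ?_⟩
    rw [integral_add i1 ihi, ihv, integral_indicator measurableSet_Ico, integral_Ico_eq_integral_Ioo,
      ← integral_Ioc_eq_integral_Ioo, ← intervalIntegral.integral_of_le huv,
      TPDCell.integral_level_sub_sigma_mul_pow, cellsMomentQ₂₃]
    push_cast
    ring

variable {T : ℚ} {cells : List TPDCell}

/-- **Moments of `γ`.** For even `q`, `t ↦ γ(t) t^q` is integrable and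
`∫ γ(t) t^q dt = 2 Σ_j momentQ_j(q)`. [folklore] -/
theorem integral_cellsGamma₂₃_mul_pow (h : CellsOK₂₃ wL T cells) {q : ℕ} (hq : Even q) :
    Integrable (fun t ↦ cellsGamma₂₃ wL cells t * t ^ q) ∧
      ∫ t, cellsGamma₂₃ wL cells t * t ^ q = 2 * (cellsMomentQ₂₃ wL cells q : ℝ) := by
  have hchain := h.chain
  have hall := h.valid
  obtain ⟨hFi, hFv⟩ := integral_gammaAux₂₃_mul_pow hall q
  set F : ℝ → ℝ := fun s ↦ gammaAux₂₃ wL cells s * s ^ q with hF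
  have hev : (fun t ↦ cellsGamma₂₃ wL cells t * t ^ q) = fun t ↦ F |t| := by
    funext t
    rw [hF, cellsGamma₂₃]
    simp only
    rw [hq.pow_abs]
  rw [hev]
  -- support of `F` is in `[0, T]`
  have hF0 : ∀ s, s ∉ Ici (0 : ℝ) → F s = 0 := fun s hs ↦ by
    rw [hF]
    simp only
    rw [gammaAux₂₃_eq_zero hchain hall (Or.inl (by simpa using hs)), zero_mul]
  constructor
  · -- integrability of `F ∘ |·|`: bounded with compact support, measurable
    obtain ⟨B, hB⟩ := exists_abs_gammaAux₂₃_le wL cells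
    have hT0 : (0 : ℝ) ≤ T := by exact_mod_cast (chain_bounds₂₃ hchain hall).1
    have hmeas : Measurable fun t ↦ F |t| := by
      rw [hF]
      exact ((measurable_gammaAux₂₃ wL cells).mul (measurable_id.pow_const q)).comp
        continuous_abs.measurable
    have hconst : IntegrableOn (fun _ : ℝ ↦ B * (T : ℝ) ^ q) (Icc (-(T : ℝ)) T) :=
      integrableOn_const measure_Icc_lt_top.ne
    refine Integrable.mono' ((integrable_indicator_iff measurableSet_Icc).2 hconst)
      hmeas.aestronglyMeasurable (Eventually.of_forall fun t ↦ ?_)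
    by_cases ht : |t| < T
    · have hmem : t ∈ Icc (-(T : ℝ)) T := ⟨by linarith [neg_abs_le t], by linarith [le_abs_self t]⟩
      rw [Set.indicator_of_mem hmem, hF, Real.norm_eq_abs]
      simp only
      rw [abs_mul, abs_pow, abs_abs]
      exact mul_le_mul (hB _) (pow_le_pow_left₀ (abs_nonneg t) ht.le q) (by positivity)
        ((abs_nonneg _).trans (hB 0))
    · push Not at ht
      rw [hF, Real.norm_eq_abs]
      simp only
      rw [gammaAux₂₃_eq_zero hchain hall (Or.inr ht), zero_mul, abs_zero]
      exact Set.indicator_nonneg (fun _ _ ↦ by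
        have := (abs_nonneg _).trans (hB 0); positivity) _
  · rw [integral_comp_abs (f := F), ← integral_Ici_eq_integral_Ioi,
      setIntegral_eq_integral_of_forall_compl_eq_zero hF0, hFv]

end Moments

/-! ## Sup bounds `|γ| ≤ Σ_j bnd_j`, `|γ| ≤ max_j bnd_j`, and the `|γ|`-moments -/

/-- `Σ_j bnd_j`, a bound for `sup |γ|`. [folklore] -/
def cellsBndSumQ₂₃ (wL : ℚ) : List TPDCell → ℚ
  | [] => 0
  | c :: cs => c.bndQ wL + cellsBndSumQ₂₃ wL cs

/-- `step(s) ≤ Σ_j bnd_j`. [folklore] -/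
theorem stepAux₂₃_le_bndSum {wL : ℚ} {cells : List TPDCell} (hall : ∀ c ∈ cells, c.Valid)
    (s : ℝ) : stepAux₂₃ wL cells s ≤ (cellsBndSumQ₂₃ wL cells : ℝ) := by
  induction cells with
  | nil => simp [stepAux₂₃, cellsBndSumQ₂₃]
  | cons c cs ih =>
    simp only [stepAux₂₃, cellsBndSumQ₂₃]
    push_cast
    refine add_le_add ?_ (ih fun c' hc' ↦ hall c' (by simp [hc']))
    have hb0 : (0 : ℝ) ≤ ((c.bndQ wL : ℚ) : ℝ) := by
      exact_mod_cast (hall c (by simp)).bndQ_nonneg wL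
    by_cases hs : s ∈ Ico (c.fp.psi.u : ℝ) c.fp.psi.v
    · rw [Set.indicator_of_mem hs]
    · rw [Set.indicator_of_notMem hs]; exact hb0

/-- `0 ≤ Σ_j bnd_j`. [folklore] -/
theorem cellsBndSumQ₂₃_nonneg {wL : ℚ} {cells : List TPDCell} (hall : ∀ c ∈ cells, c.Valid) :
    (0 : ℝ) ≤ (cellsBndSumQ₂₃ wL cells : ℝ) :=
  le_trans ((stepAux₂₃_props (wL := wL) hall).1.choose_spec 0).1 (stepAux₂₃_le_bndSum hall 0)

/-- `max_j bnd_j` (`0` for no cells). [folklore] -/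
def cellsBndMaxQ₂₃ (wL : ℚ) : List TPDCell → ℚ
  | [] => 0
  | c :: cs => max (c.bndQ wL) (cellsBndMaxQ₂₃ wL cs)

/-- `0 ≤ max_j bnd_j`. [folklore] -/
theorem cellsBndMaxQ₂₃_nonneg (wL : ℚ) : ∀ cells : List TPDCell, 0 ≤ cellsBndMaxQ₂₃ wL cells
  | [] => le_rfl
  | _ :: cs => (cellsBndMaxQ₂₃_nonneg wL cs).trans (le_max_right _ _)

section AbsMoments

variable {wL T : ℚ} {cells : List TPDCell}

/-- `step` vanishes off `[s₀, T)` for a chain of valid cells from `s₀` to `T`. [folklore] -/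
theorem stepAux₂₃_eq_zero {s₀ : ℚ} (hchain : checkChain₂₃ cells s₀ T = true)
    (hall : ∀ c ∈ cells, c.Valid) {x : ℝ} (hx : x < s₀ ∨ (T : ℝ) ≤ x) :
    stepAux₂₃ wL cells x = 0 := by
  induction cells generalizing s₀ with
  | nil => rfl
  | cons c cs ih =>
    have hb := chain_bounds₂₃ hchain hall
    simp only [checkChain₂₃, Bool.and_eq_true, decide_eq_true_eq] at hchain
    have hcv : (c.fp.psi.v : ℝ) ≤ T := by exact_mod_cast (hb.2 c (by simp)).2
    have huv : (c.fp.psi.u : ℝ) < c.fp.psi.v := by exact_mod_cast (hall c (by simp)).u_lt_v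
    have hus : (c.fp.psi.u : ℝ) = s₀ := by exact_mod_cast hchain.1
    simp only [stepAux₂₃]
    rw [ih hchain.2 (fun c' hc' ↦ hall c' (by simp [hc'])) ?_, add_zero, Set.indicator_of_notMem]
    · rintro ⟨h1, h2⟩
      rcases hx with hx | hx <;> linarith
    · rcases hx with hx | hx
      · left; linarith
      · right; exact hx

/-- `step(s) ≤ max_j bnd_j` for a chain (the cells are disjoint, so at most one term is live). [folklore] -/
theorem stepAux₂₃_le_bndMax {s₀ : ℚ} (hchain : checkChain₂₃ cells s₀ T = true)
    (hall : ∀ c ∈ cells, c.Valid) (s : ℝ) :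
    stepAux₂₃ wL cells s ≤ (cellsBndMaxQ₂₃ wL cells : ℝ) := by
  induction cells generalizing s₀ with
  | nil => simp [stepAux₂₃, cellsBndMaxQ₂₃]
  | cons c cs ih =>
    simp only [checkChain₂₃, Bool.and_eq_true, decide_eq_true_eq] at hchain
    have hall' : ∀ c' ∈ cs, c'.Valid := fun c' hc' ↦ hall c' (by simp [hc'])
    simp only [stepAux₂₃, cellsBndMaxQ₂₃]
    push_cast
    by_cases hs : s ∈ Ico (c.fp.psi.u : ℝ) c.fp.psi.v
    · -- the live cell is `c`; the rest of the chain starts at `v > s`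
      rw [Set.indicator_of_mem hs, stepAux₂₃_eq_zero hchain.2 hall' (Or.inl hs.2), add_zero]
      exact le_max_left _ _
    · rw [Set.indicator_of_notMem hs, zero_add]
      exact (ih hchain.2 hall').trans (le_max_right _ _)

/-- **Sup bound for the signed minorant.** `|γ(t)| ≤ Σ_j bnd_j` for all real `t`. [folklore] -/
theorem abs_cellsGamma₂₃_le_bndSum (h : CellsOK₂₃ wL T cells) (t : ℝ) :
    |cellsGamma₂₃ wL cells t| ≤ (cellsBndSumQ₂₃ wL cells : ℝ) := by
  have hall := h.valid
  unfold cellsGamma₂₃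
  exact (abs_gammaAux₂₃_le_step hall |t|).trans (stepAux₂₃_le_bndSum hall |t|)

/-- **Sup bound for the signed minorant (sharp form).** `|γ(t)| ≤ max_j bnd_j`. [folklore] -/
theorem abs_cellsGamma₂₃_le_bndMax (h : CellsOK₂₃ wL T cells) (t : ℝ) :
    |cellsGamma₂₃ wL cells t| ≤ (cellsBndMaxQ₂₃ wL cells : ℝ) := by
  unfold cellsGamma₂₃
  exact (abs_gammaAux₂₃_le_step h.valid |t|).trans (stepAux₂₃_le_bndMax h.chain h.valid |t|)

/-- **`|γ|`-moments.** For even `q`, `t ↦ |γ(t)| t^q` is integrable and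
`∫ |γ(t)| t^q dt ≤ 2 · cellsAbsMomentQ₂₃(q)`. [folklore] -/
theorem integral_abs_cellsGamma₂₃_mul_pow_le (h : CellsOK₂₃ wL T cells) {q : ℕ}
    (hq : Even q) :
    Integrable (fun t ↦ |cellsGamma₂₃ wL cells t| * t ^ q) ∧
      ∫ t, |cellsGamma₂₃ wL cells t| * t ^ q ≤ 2 * (cellsAbsMomentQ₂₃ wL cells q : ℝ) := by
  have hchain := h.chain
  have hall := h.valid
  obtain ⟨hFi, -⟩ := integral_cellsGamma₂₃_mul_pow h hq
  obtain ⟨⟨B, hB⟩, hSm⟩ := stepAux₂₃_props (wL := wL) hall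
  obtain ⟨-, hSv⟩ := integral_stepAux₂₃_mul_pow (wL := wL) hall q
  have hT0 : (0 : ℝ) ≤ T := by exact_mod_cast (chain_bounds₂₃ hchain hall).1
  have hev : (fun t ↦ |cellsGamma₂₃ wL cells t| * t ^ q) =
      fun t ↦ |cellsGamma₂₃ wL cells t * t ^ q| := by
    funext t; rw [abs_mul, abs_pow, hq.pow_abs]
  have hint : Integrable (fun t ↦ |cellsGamma₂₃ wL cells t| * t ^ q) := by rw [hev]; exact hFi.abs
  refine ⟨hint, ?_⟩
  set G : ℝ → ℝ := fun s ↦ stepAux₂₃ wL cells s * s ^ q with hG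
  have hG0 : ∀ s, s ∉ Ici (0 : ℝ) → G s = 0 := fun s hs ↦ by
    rw [hG]; simp only
    rw [stepAux₂₃_eq_zero hchain hall (Or.inl (by simpa using hs)), zero_mul]
  have hle : ∀ t, |cellsGamma₂₃ wL cells t| * t ^ q ≤ G |t| := by
    intro t
    rw [hG]; simp only
    rw [hq.pow_abs]
    refine mul_le_mul_of_nonneg_right ?_ (by rw [← hq.pow_abs]; positivity)
    unfold cellsGamma₂₃
    exact abs_gammaAux₂₃_le_step hall |t|
  -- integrability of `G ∘ |·|`: bounded with support in `[-T, T]`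
  have hB0 : 0 ≤ B := (hB 0).1.trans (hB 0).2
  have hmeas : Measurable fun t ↦ G |t| := by
    rw [hG]; exact (hSm.mul (measurable_id.pow_const q)).comp continuous_abs.measurable
  have hconst : IntegrableOn (fun _ : ℝ ↦ B * (T : ℝ) ^ q) (Icc (-(T : ℝ)) T) :=
    integrableOn_const measure_Icc_lt_top.ne
  have hGi : Integrable fun t ↦ G |t| := by
    refine Integrable.mono' ((integrable_indicator_iff measurableSet_Icc).2 hconst)
      hmeas.aestronglyMeasurable (Eventually.of_forall fun t ↦ ?_)
    by_cases ht : |t| < T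
    · have hmem : t ∈ Icc (-(T : ℝ)) T := ⟨by linarith [neg_abs_le t], by linarith [le_abs_self t]⟩
      rw [Set.indicator_of_mem hmem, hG, Real.norm_eq_abs]
      simp only
      rw [abs_mul, abs_pow, abs_abs, abs_of_nonneg (hB _).1]
      exact mul_le_mul (hB _).2 (pow_le_pow_left₀ (abs_nonneg t) ht.le q) (by positivity) hB0
    · push Not at ht
      rw [hG, Real.norm_eq_abs]
      simp only
      rw [stepAux₂₃_eq_zero hchain hall (Or.inr ht), zero_mul, abs_zero]
      exact Set.indicator_nonneg (fun _ _ ↦ by positivity) _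
  have hmono := integral_mono hint hGi hle
  refine hmono.trans (le_of_eq ?_)
  rw [integral_comp_abs (f := G), ← integral_Ici_eq_integral_Ioi,
    setIntegral_eq_integral_of_forall_compl_eq_zero hG0, hSv]

end AbsMoments

end Literature.NumberTheory.LFunctions
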